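import Summits.BirchSwinnertonDyer.BirchSwinnertonDyer.Theorems.PrintCf2RubinValueTwoColemanCoinvariantCharArtin
import Summits.BirchSwinnertonDyer.BirchSwinnertonDyer.Theorems.PrintCf2RubinValueTwoEllipticUnitsPrincipalTwo
import HarnessLib

/-!
# Brick (c) at `p = 2`, local `χ`-part, FOR THE ELLIPTIC UNITS: `char_Λ ((N / Col 𝒞̄_ell)_ε) = (L_ε)` with
# `𝒞̄_ell = closure ⟨⟨e(𝔞)⟩^{±1} : 𝔞 ∈ I⟩` the closed group generated by the principal two-variable elliptic units — the (c)-capstone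
# `ColemanCoinvariantArtin.charIdeal_coinvariants_colemanImage_closure_eq_span_of_mul_rule` INSTANTIATED with `β := ellipticUnitsPrincipal₂`
# (inputs (i) `hβ` and (ii)(R) `hrule` DISCHARGED by `EllipticUnitsLocal₂`), modulo the layer-approximation (G), `a₁`/`a₂` (A) and `L_ε ≠ 0` (L)

Cell `bsd-print-cf2`, width seat `bsd-line-cf2c-w7` g15, route C `PrintCf2RubinValueTwo`, crux of record stmt-BirchSwinnertonDyer-24033
`TwoVariableMainConjAtSplitTwoQuad` (23720 nominal), BRICK §4(c); `--supports` the crux as a helper.  THEOREMS ONLY (0 sorry, no named fact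
asserted, no definition); CONDITIONAL on the published named facts `DeShalit1987.prop24_i/ii/iii`, `prop25_i` carried as hypotheses by the elliptic-unit
files.  Theses-free.  BSD is not proved by any of this.

* ★ `ellipticUnitsPrincipal₂_congr` — `⟨e(𝔞)⟩` depends only on the VALUES of the theta family (not on the ideal bookkeeping / witnesses), so the
  family for `𝔞𝔠` produced by the product rule IS the family indexed by `μ(a,c)` whenever `idl(μ(a,c)) = idl a · idl c`;
* ★★ `hrule_ellipticUnitsPrincipal₂` — the capstone's `hrule` for an index type `I` of ideals closed under multiplication, with theta families and
  local Artin lifts `σ̃_a`;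
* ★★★ **`charIdeal_coinvariants_colemanImage_closure_ellipticUnits_eq_span`** — de Shalit III Lemma 1.10 (17) at `q = 2`, one prime, `d = 1`, `ε`-part,
  FOR THE ELLIPTIC UNITS: given (G) the layer-approximation by the `σ̃_a`, (A) indices `a₁` (`χ_π(σ̃_{a₁}) = γ`, `b ∈ 𝔪`), `a₂` (non-zero
  Weierstrass value) and (L) `L_ε ≠ 0` with `φ_ε(Col ⟨e(𝔞_c)⟩) = (t_{χ(σ̃_c)}·C g_c − C N𝔞_c)·L_ε`, **`char_Λ ((N / Col 𝒞̄_ell)_ε) = (L_ε)`**.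

## References
* [deShalit1987] E. de Shalit, *Iwasawa theory of elliptic curves with complex multiplication* (1987), II §2.4 (ii), §4.12, §4.14; III §1.3,
  §1.4 (5), Lemma 1.10 (17).
* [SerreLocalFields1979] J.-P. Serre, *Local Fields* (1979), Ch. II §4 Prop. 8.
-/

noncomputable section

set_option linter.dupNamespace false
set_option autoImplicit false

open Filter Topology
open scoped PowerSeries.WithPiTopology
open scoped NumberField Classical

namespace Summit.BirchSwinnertonDyer.BirchSwinnertonDyer.Theorems.PrintCf2.ColemanCoinvariantEllipticUnits

open Field IsDedekindDomain IsDedekindDomain.HeightOneSpectrum ValuativeRel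
open Literature.NumberTheory.NumberFields
open Literature.NumberTheory.GaloisRepresentations Literature.NumberTheory.GaloisRepresentations.IsNonarchimedeanLocalField
  Literature.NumberTheory.GaloisRepresentations.LubinTate Literature.NumberTheory.GaloisRepresentations.ArtinLocalGlobal
open Literature.NumberTheory.EllipticCurves
open Literature.NumberTheory.ComplexMultiplication.EllipticUnits
open Literature.NumberTheory.LFunctions.AbelianDensity (artinSymbol)
open Literature.RingTheory.PowerSeries (maxEval)
open Summit.BirchSwinnertonDyer.BirchSwinnertonDyer.Theorems.PrintCf2.ColemanImage
open Summit.BirchSwinnertonDyer.BirchSwinnertonDyer.Theorems.PrintCf2.ColemanCoinvariantGalois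
open Summit.BirchSwinnertonDyer.BirchSwinnertonDyer.Theorems.PrintCf2.ColemanCoinvariantArtin
open Summit.BirchSwinnertonDyer.BirchSwinnertonDyer.Theorems.PrintCf2.EllipticUnitsLocal
open Summit.BirchSwinnertonDyer.BirchSwinnertonDyer.Theorems.PrintCf2.EllipticUnitsLocal₂

variable {K : Type} [Field K] [NumberField K] {𝔤 : Ideal (𝓞 K)} {v v' : HeightOneSpectrum (𝓞 K)}

attribute [local instance] ltNormUniformSpace ltNormIsUniformAddGroup rk1 nF nE fintypeResidueField
attribute [local instance] RelNormCoherentUnits.instCommMonoid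

section EllipticUnits

variable [NumberField.IsTotallyComplex K]
  (h24iii : DeShalit1987.prop24_iii_unit) (h25 : DeShalit1987.prop25_i_normRelation) (hK : IsImaginaryQuadratic K) (ιK : K →+* ℂ)
  (h𝔤0 : 𝔤 ≠ ⊥) (hv : ¬ 𝔤 ≤ v.asIdeal) (hvv' : v' ≠ v) (hw : ∀ u : (𝓞 K)ˣ, (u : 𝓞 K) - 1 ∈ 𝔤 * v'.asIdeal → u = 1)
  {π : 𝒪[v.adicCompletion K]} (hπ : (valuation (v.adicCompletion K)).IsUniformizer (π : v.adicCompletion K))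
  {α : ℕ → 𝓞 K} (hα0 : ∀ i, α i ≠ 0) (hα𝔪 : ∀ i, α i - 1 ∈ 𝔤 * v'.asIdeal ^ (i + 1))
  (hαw : ∀ i, ∀ w : HeightOneSpectrum (𝓞 K), w ≠ v → α i ∉ w.asIdeal)
  {f : ℕ → ℕ} (hαπ : ∀ i, ((α i : K) : v.adicCompletion K) = (π : v.adicCompletion K) ^ f i)
  [CharZero (v.adicCompletion K)]
  (E : ℕ → IntermediateField (v.adicCompletion K) (AlgebraicClosure (v.adicCompletion K)))
  [∀ j, FiniteDimensional (v.adicCompletion K) (E j)] [∀ j, IsGalois (v.adicCompletion K) (E j)]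
  (hmono : Monotone E) (c : ℕ) (hEc : ∀ i, E (i + c) ≤ maxUnramified (v.adicCompletion K))
  (hdegEc : ∀ i, ∀ w : WeilGroup (v.adicCompletion K),
    WeilGroup.toAbsGalois (v.adicCompletion K) w ∈ (E (i + c)).fixingSubgroup → (f i : ℤ) ∣ WeilGroup.deg w)

/-- ★ **`⟨e(𝔞)⟩` depends only on the values of the theta family**: for two ideals `𝔞`, `𝔞'` and theta families `x`, `x'` with the same values in
`K̄` (the ideal enters the construction only through propositional witnesses), the principal two-variable families coincide.
[cite: deShalit1987, II.4.5 (12) (p. 58)] -/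
theorem ellipticUnitsPrincipal₂_congr {𝔞 𝔞' : Ideal (𝓞 K)} (h𝔞0 : 𝔞 ≠ ⊥) (h𝔞c : IsCoprime 𝔞 (𝔤 * v.asIdeal * v'.asIdeal))
    (h𝔞'0 : 𝔞' ≠ ⊥) (h𝔞'c : IsCoprime 𝔞' (𝔤 * v.asIdeal * v'.asIdeal))
    (x x' : ∀ i k : ℕ, rayClassField K (𝔤 * v'.asIdeal ^ (i + 1) * v.asIdeal ^ (k + 1)))
    (hx : ∀ i k : ℕ, IsThetaValueOne ιK (𝔤 * v'.asIdeal ^ (i + 1) * v.asIdeal ^ (k + 1)) 𝔞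
      (algClosureEmb ιK ((x i k : rayClassField K (𝔤 * v'.asIdeal ^ (i + 1) * v.asIdeal ^ (k + 1))) : AlgebraicClosure K)))
    (hx' : ∀ i k : ℕ, IsThetaValueOne ιK (𝔤 * v'.asIdeal ^ (i + 1) * v.asIdeal ^ (k + 1)) 𝔞'
      (algClosureEmb ιK ((x' i k : rayClassField K (𝔤 * v'.asIdeal ^ (i + 1) * v.asIdeal ^ (k + 1))) : AlgebraicClosure K)))
    (h : ∀ i k : ℕ, ((x i k : rayClassField K (𝔤 * v'.asIdeal ^ (i + 1) * v.asIdeal ^ (k + 1))) : AlgebraicClosure K) = x' i k) :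
    ellipticUnitsPrincipal₂ h24iii h25 hK ιK h𝔤0 hv hvv' hw hπ hα0 hα𝔪 hαw hαπ E hmono c hEc hdegEc h𝔞0 h𝔞c x hx =
      ellipticUnitsPrincipal₂ h24iii h25 hK ιK h𝔤0 hv hvv' hw hπ hα0 hα𝔪 hαw hαπ E hmono c hEc hdegEc h𝔞'0 h𝔞'c x' hx' := by
  unfold ellipticUnitsPrincipal₂
  have hfam : (fun i ↦ (ellipticUnitsLocal₂ h24iii h25 hK ιK h𝔤0 hv hvv' hw hπ hα0 hα𝔪 hαw hαπ (fun i ↦ E (i + c)) hEc hdegEc h𝔞0 h𝔞c x hx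
        i).principalPart) =
      fun i ↦ (ellipticUnitsLocal₂ h24iii h25 hK ιK h𝔤0 hv hvv' hw hπ hα0 hα𝔪 hαw hαπ (fun i ↦ E (i + c)) hEc hdegEc h𝔞'0 h𝔞'c x' hx'
        i).principalPart := by
    funext i
    congr 1
    unfold ellipticUnitsLocal₂ RelNormCoherentUnits.ofGlobal₂
    exact ofGlobal_congr (moduli_ne_bot h𝔤0 v' i) (not_moduli_le hv hvv' i) (hw_moduli hw i) hπ (hα0 i) (hα𝔪 i) (hαw i) (hαπ i) (E (i + c))
      (hEc i) (hdegEc i) (h i)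
  rw [hfam]

variable (h24ii : DeShalit1987.prop24_ii_galoisAction)
  -- the index type: ideals closed under a multiplication `μ`, with theta families and local Artin lifts
  {I : Type*} (idl : I → Ideal (𝓞 K)) (μ : I → I → I) (hμidl : ∀ a c, idl (μ a c) = idl a * idl c)
  (hidl0 : ∀ a, idl a ≠ ⊥) (hidlc : ∀ a, IsCoprime (idl a) (𝔤 * v.asIdeal * v'.asIdeal))
  (x : ∀ a : I, ∀ i k : ℕ, rayClassField K (𝔤 * v'.asIdeal ^ (i + 1) * v.asIdeal ^ (k + 1)))
  (hx : ∀ a, ∀ i k : ℕ, IsThetaValueOne ιK (𝔤 * v'.asIdeal ^ (i + 1) * v.asIdeal ^ (k + 1)) (idl a)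
    (algClosureEmb ιK ((x a i k : rayClassField K (𝔤 * v'.asIdeal ^ (i + 1) * v.asIdeal ^ (k + 1))) : AlgebraicClosure K)))
  (σ : I → absoluteGaloisGroup (v.adicCompletion K))
  (hσ : ∀ a, ∀ i k : ℕ, absRestrictNormalHom (rayClassField K (𝔤 * v'.asIdeal ^ (i + 1) * v.asIdeal ^ (k + 1)))
      (absGaloisRestrict K (v.adicCompletion K) (σ a)) =
    artinSymbol (galFrob K (rayClassField K (𝔤 * v'.asIdeal ^ (i + 1) * v.asIdeal ^ (k + 1)))) (idl a))

include h24ii hμidl hσ in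
/-- ★★ **The capstone's `hrule` for the elliptic units**: for an index type of ideals closed under `μ` (`idl(μ(a,c)) = idl a·idl c`), theta families
`x_a` and local Artin lifts `σ̃_a`, `σ̃_a·⟨e(𝔞_c)⟩ = ⟨e(𝔞_{μ(a,c)})⟩·(⟨e(𝔞_a)⟩⁻¹)^{N𝔞_c}` (II.2.4 (ii) transported, `galAct_ellipticUnitsPrincipal₂_eq`,
and independence of the representatives). [cite: deShalit1987, II.2.4 Proposition (ii), II.4.12 (p. 66)] -/
theorem hrule_ellipticUnitsPrincipal₂ (a b : I) :
    (fun j ↦ (ellipticUnitsPrincipal₂ h24iii h25 hK ιK h𝔤0 hv hvv' hw hπ hα0 hα𝔪 hαw hαπ E hmono c hEc hdegEc (hidl0 b) (hidlc b) (x b) (hx b)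
        j).galAct (σ a)) =
      ellipticUnitsPrincipal₂ h24iii h25 hK ιK h𝔤0 hv hvv' hw hπ hα0 hα𝔪 hαw hαπ E hmono c hEc hdegEc (hidl0 (μ a b)) (hidlc (μ a b)) (x (μ a b))
          (hx (μ a b)) *
        (fun j ↦ (ellipticUnitsPrincipal₂ h24iii h25 hK ιK h𝔤0 hv hvv' hw hπ hα0 hα𝔪 hαw hαπ E hmono c hEc hdegEc (hidl0 a) (hidlc a) (x a) (hx a)
          j).inv hπ (E j)) ^ Ideal.absNorm (idl b) := by
  have hxab : ∀ i k : ℕ, IsThetaValueOne ιK (𝔤 * v'.asIdeal ^ (i + 1) * v.asIdeal ^ (k + 1)) (idl a * idl b)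
      (algClosureEmb ιK ((x (μ a b) i k : rayClassField K (𝔤 * v'.asIdeal ^ (i + 1) * v.asIdeal ^ (k + 1))) : AlgebraicClosure K)) := by
    rw [← hμidl]; exact hx (μ a b)
  rw [galAct_ellipticUnitsPrincipal₂_eq h24iii h25 hK ιK h𝔤0 hv hvv' hw hπ hα0 hα𝔪 hαw hαπ E hmono c hEc hdegEc (hidl0 a) (hidlc a) h24ii
    (hidl0 b) (hidlc b) ((hidlc a).mul_left (hidlc b)) (x a) (hx a) (x b) (hx b) (x (μ a b)) hxab (σ a) (hσ a),
    ellipticUnitsPrincipal₂_congr h24iii h25 hK ιK h𝔤0 hv hvv' hw hπ hα0 hα𝔪 hαw hαπ E hmono c hEc hdegEc _ _ (hidl0 (μ a b)) (hidlc (μ a b))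
      (x (μ a b)) (x (μ a b)) hxab (hx (μ a b)) (fun _ _ ↦ rfl)]

end EllipticUnits

/-! ## The (c)-capstone for the elliptic units -/

section Capstone

attribute [local instance] isAdicComplete_maximalIdeal_powerSeries_integer

variable [NumberField.IsTotallyComplex K]
  (h24iii : DeShalit1987.prop24_iii_unit) (h25 : DeShalit1987.prop25_i_normRelation) (h24ii : DeShalit1987.prop24_ii_galoisAction)
  (hK : IsImaginaryQuadratic K) (ιK : K →+* ℂ)
  (h𝔤0 : 𝔤 ≠ ⊥) (hv : ¬ 𝔤 ≤ v.asIdeal) (hvv' : v' ≠ v) (hw : ∀ u : (𝓞 K)ˣ, (u : 𝓞 K) - 1 ∈ 𝔤 * v'.asIdeal → u = 1)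
  {π : 𝒪[v.adicCompletion K]} (hπ : (valuation (v.adicCompletion K)).IsUniformizer (π : v.adicCompletion K))
  {α : ℕ → 𝓞 K} (hα0 : ∀ i, α i ≠ 0) (hα𝔪 : ∀ i, α i - 1 ∈ 𝔤 * v'.asIdeal ^ (i + 1))
  (hαw : ∀ i, ∀ w : HeightOneSpectrum (𝓞 K), w ≠ v → α i ∉ w.asIdeal)
  {f : ℕ → ℕ} (hαπ : ∀ i, ((α i : K) : v.adicCompletion K) = (π : v.adicCompletion K) ^ f i)
  [CharZero (v.adicCompletion K)]
  -- the local two-variable frame of the (c)-chain (`d = 1`)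
  {p : ℕ} [hp : Fact p.Prime] {d : ℕ} (hd : d.Coprime p)
  (E : ℕ → IntermediateField (v.adicCompletion K) (AlgebraicClosure (v.adicCompletion K)))
  [∀ j, FiniteDimensional (v.adicCompletion K) (E j)] [∀ j, Normal (v.adicCompletion K) (E j)] [∀ j, IsGalois (v.adicCompletion K) (E j)]
  (hmono : Monotone E) (hE : ∀ j, E j ≤ maxUnramified (v.adicCompletion K)) (hdeg : ∀ j, Module.finrank (v.adicCompletion K) (E j) = d * p ^ j)
  {σ₀ : absoluteGaloisGroup (v.adicCompletion K)} (hσ₀ : IsAbsArithFrob σ₀) (hq : residueFieldCard (v.adicCompletion K) = 2)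
  (u : (LTCoeff (v.adicCompletion K))ˣ) (hu : LTCoeff.of (v.adicCompletion K) π = residueFieldCard (v.adicCompletion K) * u)
  (γ w : 𝒪[v.adicCompletion K]ˣ) (hγ : (γ : 𝒪[v.adicCompletion K]) = 1 + π ^ 2 * w)
  [IsAdicComplete (Ideal.span {intBase (v.adicCompletion K) (LTCoeff.of (v.adicCompletion K) π)}) (PowerSeries 𝒪[v.adicCompletion K])]
  [NeZero d]
  {θ : ∀ j, unitBall (E j)} (hθ : ∀ j, IsIntegralNormalGen (E j) (θ j))
  (hcoh : ∀ j, unitBallTrace (hmono (Nat.le_succ j)) (θ (j + 1)) = θ j)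
  [IsAdicComplete (Ideal.span {(p : 𝒪[v.adicCompletion K])}) 𝒪[v.adicCompletion K]]
  (hI : Ideal.span {(p : 𝒪[v.adicCompletion K])} ≠ ⊤)
  (hud : ∀ j, (u : LTCoeff (v.adicCompletion K)) ^ Module.finrank (v.adicCompletion K) (E j) ≠ 1)
  (hm : ∃ m₁ : ℕ, LTCoeff.of (v.adicCompletion K) π ^ 2 ∣ LTCoeff.of (v.adicCompletion K) π - m₁)
  [Unique (ZMod d)] (hN : DenseRange (Nat.cast : ℕ → 𝒪[v.adicCompletion K]))
  -- the unramified offset and the containment data on the shifted levels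
  (c : ℕ)
  (hdegEc : ∀ i, ∀ w' : WeilGroup (v.adicCompletion K),
    WeilGroup.toAbsGalois (v.adicCompletion K) w' ∈ (E (i + c)).fixingSubgroup → (f i : ℤ) ∣ WeilGroup.deg w')
  (hinert : ∀ i, ∀ τ : absoluteGaloisGroup (v.adicCompletion K),
    (∀ y ∈ rayClassField K (𝔤 * v'.asIdeal ^ (i + 1 + 1)),
      τ • absClosureEmbedding K (v.adicCompletion K) y = absClosureEmbedding K (v.adicCompletion K) y) →
      τ ∈ (E (i + 1 + c)).fixingSubgroup)
  (hcount : ∀ i k : ℕ, IntermediateField.relfinrank (rayClassField K (𝔤 * v'.asIdeal ^ (i + 1) * v.asIdeal ^ (k + 1)))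
      (rayClassField K (𝔤 * v'.asIdeal ^ (i + 1 + 1) * v.asIdeal ^ (k + 1))) * Module.finrank (v.adicCompletion K) (E (i + c)) ≤
      Module.finrank (v.adicCompletion K) (E (i + 1 + c)))
  -- the index type
  {I : Type*} (idl : I → Ideal (𝓞 K)) (μ : I → I → I) (hμidl : ∀ a b, idl (μ a b) = idl a * idl b)
  (hidl0 : ∀ a, idl a ≠ ⊥) (hidlc : ∀ a, IsCoprime (idl a) (𝔤 * v.asIdeal * v'.asIdeal))
  (x : ∀ a : I, ∀ i k : ℕ, rayClassField K (𝔤 * v'.asIdeal ^ (i + 1) * v.asIdeal ^ (k + 1)))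
  (hx : ∀ a, ∀ i k : ℕ, IsThetaValueOne ιK (𝔤 * v'.asIdeal ^ (i + 1) * v.asIdeal ^ (k + 1)) (idl a)
    (algClosureEmb ιK ((x a i k : rayClassField K (𝔤 * v'.asIdeal ^ (i + 1) * v.asIdeal ^ (k + 1))) : AlgebraicClosure K)))
  (σ : I → absoluteGaloisGroup (v.adicCompletion K))
  (hσ : ∀ a, ∀ i k : ℕ, absRestrictNormalHom (rayClassField K (𝔤 * v'.asIdeal ^ (i + 1) * v.asIdeal ^ (k + 1)))
      (absGaloisRestrict K (v.adicCompletion K) (σ a)) =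
    artinSymbol (galFrob K (rayClassField K (𝔤 * v'.asIdeal ^ (i + 1) * v.asIdeal ^ (k + 1)))) (idl a))
  -- (G) layer-approximation
  (happrox : ∀ (τ : absoluteGaloisGroup (v.adicCompletion K)) (N : ℕ), ∃ a : I,
    ∀ z : (E N ⊔ ltField π N : IntermediateField (v.adicCompletion K) (AlgebraicClosure (v.adicCompletion K))),
      σ a • (z : AlgebraicClosure (v.adicCompletion K)) = τ • (z : AlgebraicClosure (v.adicCompletion K)))
  (ε : PowerSeries (PowerSeries 𝒪[v.adicCompletion K])) (g : I → (PowerSeries 𝒪[v.adicCompletion K])ˣ)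

include h24ii hμidl hσ hm in
/-- ★★★ **THE LOCAL (c)-IDENTITY FOR THE ELLIPTIC UNITS** (de Shalit III Lemma 1.10 (17) at `q = 2`, one prime above `v`, `d = 1`, `ε`-part): let
`⟨e(𝔞_a)⟩ ∈ 𝒰¹_∞` (`a ∈ I`, ideals closed under `μ`, prime to `𝔤vv'`) be the principal two-variable elliptic units at `𝔓` (theta families `x_a`, GIVEN
II.2.4 (i)–(iii), II.2.5 (i)), `σ̃_a ∈ Γ_{K_v}` local lifts of the Artin symbols of `𝔞_a` at every level `K(𝔤v'^{i+1}v^{k+1})`, and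
`𝒞̄_ell := closure ⟨⟨e(𝔞_a)⟩^{±1}⟩`.  GIVEN (G) the `σ̃_a` approximate every `τ ∈ Γ_{K_v}` on every layer `E_N·K_π^{N+1}`, (A) `χ_π(σ̃_{a₁}) = γ`,
`b = N𝔞_{a₁} g_{a₁}⁻¹ − 1 ∈ 𝔪`, one `a₂` with non-zero Weierstrass value, and (L) `L_ε ≠ 0` with `φ_ε(Col ⟨e(𝔞_a)⟩) = (t_{χ(σ̃_a)}·C g_a − C N𝔞_a)·L_ε`:
**`char_Λ ((N / Col 𝒞̄_ell)_ε) = (L_ε)`** — the capstone `charIdeal_coinvariants_colemanImage_closure_eq_span_of_mul_rule` with its unit-side inputs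
`hβ` (principal coherent) and `hrule` (product rule) DISCHARGED.
[cite: deShalit1987, II §2.4 (ii), §4.12 (33), §4.14; III §1.3, §1.4 (5), Cor. 1.5 (7), Lemma 1.10 (17)] [cite: SerreLocalFields1979, Ch. II §4 Prop. 8] -/
theorem charIdeal_coinvariants_colemanImage_closure_ellipticUnits_eq_span (hε : ε * ε = 1)
    (a₁ a₂ : I) (hv₁ : lubinTateChar hπ (σ a₁) = γ)
    (hn₁ : ((Ideal.absNorm (idl a₁) : ℕ) : PowerSeries 𝒪[v.adicCompletion K]) * ((g a₁)⁻¹ : (PowerSeries 𝒪[v.adicCompletion K])ˣ) - 1 ∈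
      IsLocalRing.maximalIdeal (PowerSeries 𝒪[v.adicCompletion K]))
    (ha₂ : maxEval hn₁ (colemanDeltaCoinvFun hπ hq (intBase (v.adicCompletion K)) u hu γ (eq_zero_of_C_pi_mul_eq_zero_integer hπ) w hγ ε
        (unitTwistₗ hπ hq (intBase (v.adicCompletion K)) u hu γ (lubinTateChar hπ (σ a₂)) (TActModule.ofPS _ _ 1)) -
      PowerSeries.C (((Ideal.absNorm (idl a₂) : ℕ) : PowerSeries 𝒪[v.adicCompletion K]) *
        ((g a₂)⁻¹ : (PowerSeries 𝒪[v.adicCompletion K])ˣ))) ≠ 0)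
    (L : PowerSeries (PowerSeries 𝒪[v.adicCompletion K])) (hL0 : L ≠ 0)
    (hL : ∀ b : I, colemanDeltaCoinvFun hπ hq (intBase (v.adicCompletion K)) u hu γ (eq_zero_of_C_pi_mul_eq_zero_integer hπ) w hγ ε
        (colemanImage hd hπ E hmono hE hdeg hσ₀ hq u hu γ hθ hcoh
          (closure_unitsGen_subset_principalCoherentFamilies hπ E hmono
            (fun b ↦ ellipticUnitsPrincipal₂ h24iii h25 hK ιK h𝔤0 hv hvv' hw hπ hα0 hα𝔪 hαw hαπ E hmono c (fun i ↦ hE (i + c)) hdegEc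
              (hidl0 b) (hidlc b) (x b) (hx b))
            (fun b ↦ ellipticUnitsPrincipal₂_mem_principalCoherentFamilies h24iii h25 hK ιK h𝔤0 hv hvv' hw hπ hα0 hα𝔪 hαw hαπ E hmono c
              (fun i ↦ hE (i + c)) hdegEc (hidl0 b) (hidlc b) hinert hcount (x b) (hx b))
            (mem_closure_unitsGen hπ E _ b)).1 default) =
      (colemanDeltaCoinvFun hπ hq (intBase (v.adicCompletion K)) u hu γ (eq_zero_of_C_pi_mul_eq_zero_integer hπ) w hγ ε
          (unitTwistₗ hπ hq (intBase (v.adicCompletion K)) u hu γ (lubinTateChar hπ (σ b)) (TActModule.ofPS _ _ 1)) *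
          PowerSeries.C (g b : PowerSeries 𝒪[v.adicCompletion K]) - PowerSeries.C ((Ideal.absNorm (idl b) : ℕ) : PowerSeries 𝒪[v.adicCompletion K])) * L) :
    Module.charIdeal (PowerSeries (PowerSeries 𝒪[v.adicCompletion K]))
        (↥(unitsImage₁ hd hπ E hmono hE hdeg hσ₀ hq u hu γ hθ hcoh hI hud) ⧸
          colemanCoinvRel hπ hq (intBase (v.adicCompletion K)) u hu γ ε (unitsImage₁ hd hπ E hmono hE hdeg hσ₀ hq u hu γ hθ hcoh hI hud)
            (fun _ hG => unitTwistₗ_mem_unitsImage₁ hd hπ E hmono hE hdeg hσ₀ hq u hu γ hθ hcoh hI hud (-1) hG)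
            (colemanImageSubmodule₁ hd hπ E hmono hE hdeg hσ₀ hq u hu γ hθ hcoh hN
              (closure (Submonoid.closure
                (Set.range (fun b ↦ ellipticUnitsPrincipal₂ h24iii h25 hK ιK h𝔤0 hv hvv' hw hπ hα0 hα𝔪 hαw hαπ E hmono c (fun i ↦ hE (i + c))
                  hdegEc (hidl0 b) (hidlc b) (x b) (hx b)) ∪
                  Set.range fun b ↦ fun j ↦ (ellipticUnitsPrincipal₂ h24iii h25 hK ιK h𝔤0 hv hvv' hw hπ hα0 hα𝔪 hαw hαπ E hmono c
                    (fun i ↦ hE (i + c)) hdegEc (hidl0 b) (hidlc b) (x b) (hx b) j).inv hπ (E j)) :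
                Set (∀ j, RelNormCoherentUnits hπ (E j))))
              isClosed_closure
              (closure_unitsGen_subset_principalCoherentFamilies hπ E hmono _
                (fun b ↦ ellipticUnitsPrincipal₂_mem_principalCoherentFamilies h24iii h25 hK ιK h𝔤0 hv hvv' hw hπ hα0 hα𝔪 hαw hαπ E hmono c
                  (fun i ↦ hE (i + c)) hdegEc (hidl0 b) (hidlc b) hinert hcount (x b) (hx b)))
              (one_mem_closure_unitsGen hπ E _) (mul_mem_closure_unitsGen hπ E _) (inv_mem_closure_unitsGen hπ E _)
              (galAct_mem_closure_unitsGen hπ E _ (galAct_mem_closure_unitsGen_of_mul_rule hπ E hmono _ σ happrox μ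
                (fun b ↦ Ideal.absNorm (idl b))
                (hrule_ellipticUnitsPrincipal₂ h24iii h25 hK ιK h𝔤0 hv hvv' hw hπ hα0 hα𝔪 hαw hαπ E hmono c (fun i ↦ hE (i + c)) hdegEc h24ii
                  idl μ hμidl hidl0 hidlc x hx σ hσ))))) =
      Ideal.span {L} :=
  charIdeal_coinvariants_colemanImage_closure_eq_span_of_mul_rule hd hπ E hmono hE hdeg hσ₀ hq u hu γ w hγ hθ hcoh hI hud hm hN
    (fun b ↦ ellipticUnitsPrincipal₂ h24iii h25 hK ιK h𝔤0 hv hvv' hw hπ hα0 hα𝔪 hαw hαπ E hmono c (fun i ↦ hE (i + c)) hdegEc (hidl0 b) (hidlc b)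
      (x b) (hx b))
    (fun b ↦ ellipticUnitsPrincipal₂_mem_principalCoherentFamilies h24iii h25 hK ιK h𝔤0 hv hvv' hw hπ hα0 hα𝔪 hαw hαπ E hmono c
      (fun i ↦ hE (i + c)) hdegEc (hidl0 b) (hidlc b) hinert hcount (x b) (hx b))
    ε σ g (fun b ↦ Ideal.absNorm (idl b)) μ
    (hrule_ellipticUnitsPrincipal₂ h24iii h25 hK ιK h𝔤0 hv hvv' hw hπ hα0 hα𝔪 hαw hαπ E hmono c (fun i ↦ hE (i + c)) hdegEc h24ii idl μ hμidl
      hidl0 hidlc x hx σ hσ)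
    happrox hε a₁ a₂ hv₁ hn₁ ha₂ L hL0 hL

end Capstone

end Summit.BirchSwinnertonDyer.BirchSwinnertonDyer.Theorems.PrintCf2.ColemanCoinvariantEllipticUnits

end
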